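import Literature.Computability.QuantumComplexity.Lemma24Gadget
import Literature.Computability.QuantumComplexity.Lemma24Main
import HarnessLib

/-!
# Aaronson–Ambainis Lemma 24 over the sign basis, XI-a: the gate codes of the instance, arithmetically

Part of the discharge of `AaronsonAmbainis2018_lemma24_sign_hard` (plan in `Lemma24Catalysis.lean`).
The polynomial-time computability of the instance map is a statement about strings; this file
defines the *arithmetic shadow* of the reduction, free of `Fin`-typed wires and of matrices: a
placed gate is shadowed by its opcode and the list of its wire values (`NGate`, code `NGate.code` =
the library's `QGate.encode` format), and the gate list of the instance is rebuilt from the input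
bits `x`, the numbers `n, m` and the shadows of the gates of the simulated circuit by `List`
operations and `+`, `*` on `ℕ` only (`instNL`). `Lemma24Shadow.lean` proves that `instNL` lists the
shadows of the gates of `lemma24Instance`, and `Lemma24CodesFP.lean` computes its code in
polynomial time (Arora–Barak 2009, §6.1: descriptions of circuits are lists of gate types and wire
numbers).

## References

* S. Aaronson, A. Ambainis, *Forrelation*, SIAM J. Comput. 47 (2018), §6, Lemma 24 (p. 26).
* S. Arora, B. Barak, *Computational Complexity: A Modern Approach*, CUP 2009, §0.1, §6.1.
-/

namespace Literature.Computability.QuantumComplexity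

open _root_.Computability Complexity Cryptography

namespace Lemma24

/-! ### Shadows of placed gates and their codes -/

/-- The shadow of a placed gate: its opcode and the values of its wires.
[cite: AroraBarak2009, §6.1 (descriptions of circuits)] -/
structure NGate where
  /-- The opcode (`Encodable.encode` of the gate symbol). -/
  op : ℕ
  /-- The wire values, in placement order. -/
  ws : List ℕ
  deriving DecidableEq

/-- The code of a shadow: tag bit `false`, opcode in binary, the wire list
(`encodingListNatBool`: unary length, then the binary numerals). [cite: AroraBarak2009, §6.1] -/
def NGate.code (g : NGate) : List Bool :=
  false :: boolPair (encodeNat g.op) (encodingListNatBool.encode g.ws)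

/-- Renaming the wires of a shadow along `θ`. [folklore] -/
def NGate.ren (θ : ℕ → ℕ) (g : NGate) : NGate := ⟨g.op, g.ws.map θ⟩

/-- Translating a shadow: add `d` to every wire value. [folklore] -/
def NGate.shift (d : ℕ) (g : NGate) : NGate := g.ren (· + d)

/-- `shift` unfolded. [folklore] -/
theorem NGate.shift_eq (d : ℕ) (g : NGate) : g.shift d = ⟨g.op, g.ws.map (· + d)⟩ := rfl

/-- Renaming twice. [folklore] -/
theorem NGate.ren_ren (θ θ' : ℕ → ℕ) (g : NGate) : (g.ren θ).ren θ' = g.ren (θ' ∘ θ) := by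
  simp [NGate.ren, List.map_map]

/-- Shifting twice. [folklore] -/
theorem NGate.shift_shift (d d' : ℕ) (g : NGate) : (g.shift d).shift d' = g.shift (d + d') := by
  rw [NGate.shift, NGate.shift, NGate.ren_ren]; congr 1; funext v; simp [Nat.add_assoc]

/-- Shifting by `0`. [folklore] -/
@[simp] theorem NGate.shift_zero (g : NGate) : g.shift 0 = g := by
  cases g; simp [NGate.shift, NGate.ren]

/-! ### The words of the reduction on shadows -/

/-- **The sign-basis words of the Clifford+`T` gates, on shadows** (opcodes `H = 0`, `S = 1`, `T = 2`,
`CNOT = 3` in; `H = 0`, `Z = 1`, `CZ = 2`, `CCZ = 3` out; catalyst `K`, real/imaginary wire `K + 2`).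
[cite: AaronsonAmbainis2018, §6 Lemma 24 (p. 26)] -/
def realGatesN' (cat rho : ℕ) : NGate → List NGate
  | ⟨0, [q]⟩ => [⟨0, [q]⟩]
  | ⟨1, [q]⟩ => [⟨2, [q, rho]⟩, ⟨0, [rho]⟩, ⟨2, [q, rho]⟩, ⟨0, [rho]⟩]
  | ⟨2, [q]⟩ => [⟨0, [cat]⟩, ⟨2, [q, cat]⟩, ⟨0, [cat]⟩, ⟨3, [q, cat, rho]⟩, ⟨0, [rho]⟩, ⟨3, [q, cat, rho]⟩, ⟨0, [rho]⟩]
  | ⟨3, [c, t]⟩ => [⟨0, [t]⟩, ⟨2, [c, t]⟩, ⟨0, [t]⟩]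
  | _ => []

/-- The sign-basis words with the catalyst `K` and the real/imaginary wire `K + 2` of a `K`-wire working
register. [cite: AaronsonAmbainis2018, §6 Lemma 24 (p. 26)] -/
abbrev realGatesN (K : ℕ) : NGate → List NGate := realGatesN' K (K + 2)

/-- **The sign-basis words are equivariant under renaming of wires.** [folklore] -/
theorem ren_realGatesN' (θ : ℕ → ℕ) (cat rho : ℕ) (g : NGate) :
    (realGatesN' cat rho g).map (NGate.ren θ) = realGatesN' (θ cat) (θ rho) (g.ren θ) := by
  rcases g with ⟨op, ws⟩
  rcases ws with _ | ⟨a, _ | ⟨b, _ | ⟨c, ws⟩⟩⟩ <;> rcases op with _ | _ | _ | _ | op <;> rfl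

/-- **The Clifford+`T` word of `NOT`** on shadows: `H S S H`. [cite: NielsenChuang2010, Ex. 4.18] -/
def xWordN (i : ℕ) : List NGate := [⟨0, [i]⟩, ⟨1, [i]⟩, ⟨1, [i]⟩, ⟨0, [i]⟩]

/-- The `NOT` word is equivariant. [folklore] -/
theorem ren_xWordN (θ : ℕ → ℕ) (i : ℕ) : (xWordN i).map (NGate.ren θ) = xWordN (θ i) := rfl

/-- **The Clifford+`T` word of Toffoli** on shadows: `H_c`, the 22-gate `CCZ` word, `H_c`.
[cite: NielsenChuang2010, §4.3 Fig. 4.9] -/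
def toffoliWordN (a b c : ℕ) : List NGate :=
  [⟨0, [c]⟩,
   ⟨2, [a]⟩, ⟨2, [b]⟩, ⟨2, [c]⟩,
   ⟨3, [a, b]⟩, ⟨1, [b]⟩, ⟨1, [b]⟩, ⟨1, [b]⟩, ⟨2, [b]⟩,
   ⟨3, [b, c]⟩, ⟨2, [c]⟩,
   ⟨3, [a, c]⟩, ⟨1, [c]⟩, ⟨1, [c]⟩, ⟨1, [c]⟩, ⟨2, [c]⟩,
   ⟨3, [b, c]⟩, ⟨1, [c]⟩, ⟨1, [c]⟩, ⟨1, [c]⟩, ⟨2, [c]⟩,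
   ⟨3, [a, c]⟩, ⟨3, [a, b]⟩,
   ⟨0, [c]⟩]

/-- The Toffoli word is equivariant. [folklore] -/
theorem ren_toffoliWordN (θ : ℕ → ℕ) (a b c : ℕ) :
    (toffoliWordN a b c).map (NGate.ren θ) = toffoliWordN (θ a) (θ b) (θ c) := rfl

/-- **The preparation words from the input bits**: for each copy `i < 4` and each position `l < n`
with `x_l = 1`, the `NOT` word on wire `i·(n+m) + l`. [cite: AaronsonAmbainis2018, §6 Lemma 24 (p. 26)] -/
def prepNL (n m : ℕ) (xb : List Bool) : List NGate :=
  (List.range 4).flatMap fun i => (List.range n).flatMap fun l =>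
    if xb.getD l false = true then xWordN (i * (n + m) + l) else []

/-- **The OR program on shadows** (for `0 < w`): four `NOT` words on the acceptance wires `i·w`,
three Toffoli words through `4w, 4w+1` into the flag `4w+2`, a `NOT` word on the flag.
[cite: AaronsonAmbainis2018, §6 Lemma 24 (p. 26)] -/
def orN (w : ℕ) : List NGate :=
  if 0 < w then orN' 0 w (2 * w) (3 * w) (4 * w) (4 * w + 1) (4 * w + 2) else []
where
  /-- The OR program on named wires `a₀ a₁ a₂ a₃ anc₁ anc₂ flag`. -/
  orN' (a0 a1 a2 a3 n1 n2 fl : ℕ) : List NGate :=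
    xWordN a0 ++ (xWordN a1 ++ (xWordN a2 ++ (xWordN a3 ++
      (toffoliWordN a0 a1 n1 ++ (toffoliWordN n1 a2 n2 ++ (toffoliWordN n2 a3 fl ++ (xWordN fl ++ [])))))))

/-- The OR program is equivariant. [folklore] -/
theorem ren_orN' (θ : ℕ → ℕ) (a0 a1 a2 a3 n1 n2 fl : ℕ) :
    (orN.orN' a0 a1 a2 a3 n1 n2 fl).map (NGate.ren θ) = orN.orN' (θ a0) (θ a1) (θ a2) (θ a3) (θ n1) (θ n2) (θ fl) := by
  simp only [orN.orN', List.map_append, ren_xWordN, ren_toffoliWordN, List.map_nil]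

/-- The shadows of the four copies: the shadows of `C` translated by `0, w, 2w, 3w`. [cite: NielsenChuang2010, §2.1.7] -/
def copiesN (w : ℕ) (cs : List NGate) : List NGate :=
  (List.range 4).flatMap fun i => cs.map (NGate.shift (i * w))

/-- **The working circuit on shadows.** [cite: AaronsonAmbainis2018, §6 Lemma 24 (p. 26)] -/
def mainNL (n m : ℕ) (xb : List Bool) (cs : List NGate) : List NGate :=
  prepNL n m xb ++ (copiesN (n + m) cs ++ orN (n + m))

/-- The shadows of the gadget on named wires `(cat, ρ, hlp)`. [cite: AaronsonAmbainis2018, §6 Lemma 24 (p. 26)] -/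
def gadgetN' (cat rho hlp : ℕ) : List NGate :=
  gadgetOps.map fun o => match o with
    | GOp.H0 => ⟨0, [cat]⟩
    | GOp.H1 => ⟨0, [rho]⟩
    | GOp.H2 => ⟨0, [hlp]⟩
    | GOp.Z0 => ⟨1, [cat]⟩
    | GOp.CZ01 => ⟨2, [cat, rho]⟩
    | GOp.CZ02 => ⟨2, [cat, hlp]⟩
    | GOp.CCZ => ⟨3, [cat, rho, hlp]⟩

/-- The shadows of the gadget of a `K`-wire working register: `cat = K`, `ρ = K + 2`, `hlp = K + 1`.
[cite: AaronsonAmbainis2018, §6 Lemma 24 (p. 26)] -/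
abbrev gadgetN (K : ℕ) : List NGate := gadgetN' K (K + 2) (K + 1)

/-- The gadget is equivariant. [folklore] -/
theorem ren_gadgetN' (θ : ℕ → ℕ) (cat rho hlp : ℕ) :
    (gadgetN' cat rho hlp).map (NGate.ren θ) = gadgetN' (θ cat) (θ rho) (θ hlp) := by
  rw [gadgetN', gadgetN', List.map_map]
  refine List.map_congr_left fun o _ => ?_
  cases o <;> rfl

/-- The shadows of the copy word on `(f, f')`. [cite: BennettBernsteinBrassardVazirani1997, Thm. 4.14 (proof)] -/
def copyN (f f' : ℕ) : List NGate := [⟨0, [f']⟩, ⟨2, [f, f']⟩, ⟨0, [f']⟩, ⟨0, [f']⟩, ⟨1, [f']⟩, ⟨0, [f']⟩]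

/-- The copy word is equivariant. [folklore] -/
theorem ren_copyN (θ : ℕ → ℕ) (f f' : ℕ) : (copyN f f').map (NGate.ren θ) = copyN (θ f) (θ f') := rfl

/-- **One block on shadows**: gadget, transcription of the working circuit, copy word, and the first
two backwards. [cite: AaronsonAmbainis2018, §6 Lemma 24 (p. 26)] -/
def blockNL (n m : ℕ) (xb : List Bool) (cs : List NGate) : List NGate :=
  (gadgetN (Kw (n + m)) ++ (mainNL n m xb cs).flatMap (realGatesN (Kw (n + m)))) ++
    (copyN (4 * (n + m) + 2) (4 * (n + m) + 3) ++
      (gadgetN (Kw (n + m)) ++ (mainNL n m xb cs).flatMap (realGatesN (Kw (n + m)))).reverse)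

/-- **The instance on shadows**: `24` blocks translated by `j·(K+3)`. [cite: AaronsonAmbainis2018, §6 Lemma 24 (p. 26)] -/
def instNL (n m : ℕ) (xb : List Bool) (cs : List NGate) : List NGate :=
  (List.range 24).flatMap fun j => (blockNL n m xb cs).map (NGate.shift (j * (Kw (n + m) + 2 + 1)))

end Lemma24

end Literature.Computability.QuantumComplexity
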